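import Summits.BirchSwinnertonDyer.BirchSwinnertonDyer.Theorems.EisensteinPrimesGoodLatticeBDPValueOfLambdaIdentityTorsD
import HarnessLib

/-!
# Route `EisensteinPrimes`, crux 2 `GoodLatticeBDPValue`, line `halves` v19.1 → v20: the crux BY NAME with the
# `λ`-identity required ONLY UNDER the cotorsion / `μ = 0` facts — part 2: the [AN]-in-the-ℚ-currency composition

Cell `bsd-eis`, seat `bsd-line-x1-p1` LEAD g4. The v19 composition (`…OfLambdaIdentityAnQ`, p637183) consumes the bare
`λ`-identity `h141lam` of KY Thm. 1.4.1 (iii) for ARBITRARY dual data `DSsub, DSquot`. The V21 index road proves that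
identity from `corank` bookkeeping, which reads `λ = zpCorank` only for finitely generated torsion `Λ`-modules with `μ = 0` —
facts the composition HAS at the point of use (`Thm141TorsionClauses.moduleFinite_isTorsion_muInvariant_eq_zero_of_forall_dualData`
for `𝔛^{Sf}_f`, [PWL-θ]'s `hSsub/hSquot` for the character dual data). This file is the same composition with the WEAKER
hypothesis `h141lamTD` = `h141lam` with the three facts for `𝔛^{Sf}_f` and the two `∀ D` cotorsion statements of [PWL-θ] (`hSsub`, `hSquot`, for EVERY dual data) as extra antecedents (variant `TD` of p646154/p646413's `T`, whose antecedents were the facts for the given `DSsub, DSquot` only — too weak to feed Greenberg's SUR criterion inside the index road) (`thm151ConclusionLE_of_lambdaTD_at`,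
`goodLatticeMuLambdaOnTree_of_div_of_le_of_lambdaTD_of_anQ`, `goodLatticeBDPValue_of_pub_of_lambdaTD_of_le_of_anQ`): the proofs of
p636387 §1 and p637183 §1–§2 line by line, the identity being invoked after the cotorsion clauses are obtained. CONDITIONAL on the
same named facts as before; nothing booked; no summit statement / BSD / IMC2 proved. Helper `--supports stmt-BirchSwinnertonDyer-19032`.

References: [KellerYin2024] Thm. 1.4.1, proof of Thm. 1.5.1 and Thm. 3.0.8 (arXiv:2402.12781v2); [CastellaGrossiLeeSkinner2022]
proof of Thm. 1.5.1; the V21 road memo `Cruxes/GoodLatticeBDPValue/Lines/halves-imprimLambda-index-road.md`.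
-/

set_option linter.dupNamespace false
set_option autoImplicit false

noncomputable section

open scoped Classical

open PowerSeries WeierstrassCurve NumberField IsDedekindDomain Field Rat.HeightOneSpectrum
  Literature.NumberTheory.EllipticCurves Literature.NumberTheory.EllipticCurves.ModularForms
  Literature.NumberTheory.QuadraticFields Literature.NumberTheory.EllipticCurves.Rank1Residual
  Literature.NumberTheory.EllipticCurves.Castella2018 Literature.NumberTheory.EllipticCurves.KellerYin2024
  Literature.NumberTheory.EllipticCurves.CastellaGrossiLeeSkinner2022 Literature.NumberTheory.GaloisRepresentations
  Literature.NumberTheory.EllipticCurves.GreenbergVatsal2000 Literature.NumberTheory.EllipticCurves.GreenbergSelmer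
  Literature.NumberTheory.EllipticCurves.IwasawaAlgebra Literature.NumberTheory.EllipticCurves.BCGKPST2020
  Literature.NumberTheory.EllipticCurves.Rubin1991 Literature.NumberTheory.EllipticCurves.DeShalit1987
  Literature.NumberTheory.EllipticCurves.Hida2010MuInvariant Literature.NumberTheory.IwasawaTheory
  Literature.NumberTheory.IwasawaTheory.Greenberg2016 Literature.NumberTheory.IwasawaTheory.Greenberg2006
open Summit.BirchSwinnertonDyer.Rank1Residual.X11b.Halves Summit.BirchSwinnertonDyer.Rank1Residual.X1.KellerYinHalves
  Summit.BirchSwinnertonDyer.Rank1Residual.X1.KellerYinMuLambdaSplit Summit.BirchSwinnertonDyer.BirchSwinnertonDyer.Theorems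
  Summit.BirchSwinnertonDyer.Rank1Residual.X1.KellerYinMuLambdaSplitDS
  Summit.BirchSwinnertonDyer.Rank1Residual.X1.KellerYinMuLambdaSplitDSFree
  Summit.BirchSwinnertonDyer.BirchSwinnertonDyer.Theorems.IwasawaTwoVariable
  Summit.BirchSwinnertonDyer.BirchSwinnertonDyer.Theorems.EisensteinPrimesMuLambda
  Summit.BirchSwinnertonDyer.BirchSwinnertonDyer.Theorems.GoodLatticeBDPValueHalves
  Summit.BirchSwinnertonDyer.BirchSwinnertonDyer.Theorems.GoodLatticeBDPValueOfImprimitive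

namespace Summit.BirchSwinnertonDyer.BirchSwinnertonDyer.Theorems.GoodLatticeBDPValueOfLambdaIdentityTorsDAnQ
open Summit.BirchSwinnertonDyer.BirchSwinnertonDyer.Theorems.GoodLatticeBDPValueOfOneInequality
  Summit.BirchSwinnertonDyer.BirchSwinnertonDyer.Theorems.GoodLatticeBDPValueOfLambdaIdentity
  Summit.BirchSwinnertonDyer.BirchSwinnertonDyer.Theorems.GoodLatticeBDPValueOfLambdaIdentityAnQ
  Summit.BirchSwinnertonDyer.BirchSwinnertonDyer.Theorems.GoodLatticeBDPValueOfLambdaIdentityTorsD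

/-! ## §1 `GoodLatticeMuLambdaOnTree` with [AN] in the ℚ-currency -/
/-- **L-μλ for the good lattice, [AN] in the ℚ-currency**: `GoodLatticeMuLambdaOnTree W p` from L-div (PUB∘)
+ `h141lam` (the bare `λ`-identity of KY Thm. 1.4.1, PRE) + [PWL-θ] (imprimitive form) + the class-wide `≤`
half of [PWL-f] (kernel) + `hanQ` ([AN]-DS-Free with the residual pair quantified over `ℚ`: rational line
`Φ`, Teichmüller pair, `θ_K` of `θquot|_{Γ_K}`) + the road's PUB inputs; the proof of
`…OfLambdaIdentity.goodLatticeMuLambdaOnTree_of_div_of_le_of_lambda` line by line, `hanQ` applied at the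
pair of `exists_teichmullerPair`. CONDITIONAL; nothing booked. [claim: KellerYin2024, status: under-review]
[cite: KellerYin2024, proof of Thm. 3.0.8 (arXiv:2402.12781v2 TeX L1631–1640), Thm. 1.4.1, proof of Thm. 1.5.1, Thms. 2.2.1–2.2.3]
[cite: CastellaGrossiLeeSkinner2022, Thm. 4.1.2, Rem. 4.1.3, Prop. 4.2.1, Thm. 2.2.2 with (2.16), proof of Thm. 1.5.1]
[cite: BleherEtAl2020, §3.3 Thm. 3.3.1] [cite: deShalit1987, II.6.4 Theorem (i)] [cite: Hida2010MuInvariant, Thm. I] [cite: Washington1997, §7.1, §13.2] -/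
theorem goodLatticeMuLambdaOnTree_of_div_of_le_of_lambdaTD_of_anQ
    (h141lamTD : ∀ (W : WeierstrassCurve ℚ) [W.IsElliptic] [W.IsGloballyMinimal] (p : ℕ) [Fact p.Prime],
      2 < p → Good W p → Red W p → Anom W p →
      (∀ Φ : AddSubgroup (geomTorsion W (p : ℤ)), IsRationalLine W p Φ → ¬ LineUnramifiedAt W p Φ) →
      ∀ (K : Type) [Field K] [NumberField K], IsImaginaryQuadratic K →
        SatisfiesHeegnerHypothesis (W.conductorNorm ℤ) K → SatisfiesHeegnerHypothesis p K →
        (∀ Q : (W.baseChange K).toAffine.Point, p • Q = 0 → Q = 0) →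
      ∀ (ι : K →+* ℚ_[p]) (v vbar : HeightOneSpectrum (𝓞 K)),
        (∀ x : 𝓞 K, x ∈ v.asIdeal ↔ ‖ι (x : K)‖ < 1) →
        ((p : ℕ) : 𝓞 K) ∈ vbar.asIdeal → vbar ≠ v →
      ∀ (κ : ZpExtension K p), κ.IsAnticyclotomic →
      ∀ (γ : absoluteGaloisGroup K) [Fact (κ.IsTopGenerator γ)],
      ∀ (θsub θquot : FramedGaloisRep K (padicCoeffIntegers (∅ : Set (PadicAlgCl p))) 1),
        IsResidualPairOver (W.baseChange K) p θsub θquot →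
      ∀ (Sf : Finset (HeightOneSpectrum (𝓞 K))),
        (∀ w : HeightOneSpectrum (𝓞 K), w ∈ Sf ↔ ((W.conductorNorm ℤ : ℤ) : 𝓞 K) ∈ w.asIdeal) →
      ∀ (DSsub : DatumDualData κ γ (charModule ∅ θsub)
          (AcSelmer.bdpData (charModule ∅ θsub) p vbar) (↑Sf : Set (HeightOneSpectrum (𝓞 K))))
        (DSquot : DatumDualData κ γ (charModule ∅ θquot)
          (AcSelmer.bdpData (charModule ∅ θquot) p vbar) (↑Sf : Set (HeightOneSpectrum (𝓞 K)))),
      Module.Finite (IwasawaAlgebra p) (AcSelmer.XAc (W.baseChange K) p κ vbar (↑Sf : Set (HeightOneSpectrum (𝓞 K))) γ) →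
      Module.IsTorsion (IwasawaAlgebra p) (AcSelmer.XAc (W.baseChange K) p κ vbar (↑Sf : Set (HeightOneSpectrum (𝓞 K))) γ) →
      muInvariant p (AcSelmer.XAc (W.baseChange K) p κ vbar (↑Sf : Set (HeightOneSpectrum (𝓞 K))) γ) = 0 →
      (∀ D : DatumDualData κ γ (charModule ∅ θsub)
          (AcSelmer.bdpData (charModule ∅ θsub) p vbar) (↑Sf : Set (HeightOneSpectrum (𝓞 K))),
        Module.Finite (IwasawaAlgebra p) D.X ∧ Module.IsTorsion (IwasawaAlgebra p) D.X ∧ muInvariant p D.X = 0) →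
      (∀ D : DatumDualData κ γ (charModule ∅ θquot)
          (AcSelmer.bdpData (charModule ∅ θquot) p vbar) (↑Sf : Set (HeightOneSpectrum (𝓞 K))),
        Module.Finite (IwasawaAlgebra p) D.X ∧ Module.IsTorsion (IwasawaAlgebra p) D.X ∧ muInvariant p D.X = 0) →
      lambdaInvariant p (AcSelmer.XAc (W.baseChange K) p κ vbar (↑Sf : Set (HeightOneSpectrum (𝓞 K))) γ) +
          (if ∀ σ : absoluteGaloisGroup K, θquot σ = 1 then 1 else 0) =
        lambdaInvariant p DSsub.X + lambdaInvariant p DSquot.X)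
    (h125 : prop125_residualPair_unrSelmer_imprimitive)
    (h142le : ∀ (W : WeierstrassCurve ℚ) [W.IsElliptic] [W.IsGloballyMinimal] (p : ℕ) [Fact p.Prime],
      2 < p → Good W p → Red W p → Anom W p →
      (∀ Φ : AddSubgroup (geomTorsion W (p : ℤ)), IsRationalLine W p Φ → ¬ LineUnramifiedAt W p Φ) →
      ∀ (K : Type) [Field K] [NumberField K], IsImaginaryQuadratic K →
        SatisfiesHeegnerHypothesis (W.conductorNorm ℤ) K → SatisfiesHeegnerHypothesis p K →
        (∀ Q : (W.baseChange K).toAffine.Point, p • Q = 0 → Q = 0) →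
      ∀ (ι : K →+* ℚ_[p]) (v vbar : HeightOneSpectrum (𝓞 K)),
        (∀ x : 𝓞 K, x ∈ v.asIdeal ↔ ‖ι (x : K)‖ < 1) →
        ((p : ℕ) : 𝓞 K) ∈ vbar.asIdeal → vbar ≠ v →
      ∀ (κ : ZpExtension K p), κ.IsAnticyclotomic →
      ∀ (γ : absoluteGaloisGroup K) [Fact (κ.IsTopGenerator γ)],
      ∀ (Sf : Finset (HeightOneSpectrum (𝓞 K))),
        (∀ w : HeightOneSpectrum (𝓞 K), w ∈ Sf ↔ ((W.conductorNorm ℤ : ℤ) : 𝓞 K) ∈ w.asIdeal) →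
      Module.Finite (IwasawaAlgebra p) (AcSelmer.XAc (W.baseChange K) p κ vbar ∅ γ) →
      Module.IsTorsion (IwasawaAlgebra p) (AcSelmer.XAc (W.baseChange K) p κ vbar ∅ γ) →
      zpCorank (↥(AcSelmer.selmerAc (W.baseChange K) p κ vbar (↑Sf : Set (HeightOneSpectrum (𝓞 K)))) ⧸
          (AcSelmer.selmerAc (W.baseChange K) p κ vbar (∅ : Set (HeightOneSpectrum (𝓞 K)))).addSubgroupOf
            (AcSelmer.selmerAc (W.baseChange K) p κ vbar (↑Sf : Set (HeightOneSpectrum (𝓞 K))))) p ≤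
        ∑ w ∈ Sf, curveLocalLambda κ (W.baseChange K) w)
    (hanQ : ∀ (W : WeierstrassCurve ℚ) [W.IsElliptic] [W.IsGloballyMinimal] (p : ℕ) [Fact p.Prime],
      2 < p → Good W p → Red W p → Anom W p →
      (∀ Φ : AddSubgroup (geomTorsion W (p : ℤ)), IsRationalLine W p Φ → ¬ LineUnramifiedAt W p Φ) →
      ∀ (K : Type) [Field K] [NumberField K], IsImaginaryQuadratic K →
        SatisfiesHeegnerHypothesis (W.conductorNorm ℤ) K → SatisfiesHeegnerHypothesis p K →
        Odd (NumberField.discr K) → NumberField.discr K ≠ -3 →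
        (∀ Q : (W.baseChange K).toAffine.Point, p • Q = 0 → Q = 0) →
      ∀ (ι : K →+* ℚ_[p]) (v vbar : HeightOneSpectrum (𝓞 K)),
        (∀ x : 𝓞 K, x ∈ v.asIdeal ↔ ‖ι (x : K)‖ < 1) →
        ((p : ℕ) : 𝓞 K) ∈ vbar.asIdeal → vbar ≠ v →
      ∀ (κ : ZpExtension K p), κ.IsAnticyclotomic →
      ∀ (γ : absoluteGaloisGroup K) [Fact (κ.IsTopGenerator γ)],
      ∀ (N : ℕ) [NeZero N] (Dt : ModularParametrizationData W N),
      ∀ (ι' : PadicAlgCl p ≃+* ℂ),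
        (∀ (w : InfinitePlace K) (k : 𝓞 K), k ∈ v.asIdeal ↔ ‖ι'.symm (w.embedding (k : K))‖ < 1) →
      ∀ (ΩK : ℂ) (Ωp : (unrIntegers p)ˣ) (L : UnrSeries p), ΩK ≠ 0 →
        IsBDPLFunction ι' v κ γ Dt.f ΩK ((Ωp : unrIntegers p) : ℂ_[p]) L →
      ∀ (Φ : AddSubgroup (geomTorsion W (p : ℤ))), IsRationalLine W p Φ →
      ∀ (θsub θquot : FramedGaloisRep ℚ (padicCoeffIntegers (∅ : Set (PadicAlgCl p))) 1),
        IsTeichmullerLiftOn (∅ : Set (PadicAlgCl p)) (Φ.map (geomTorsion W (p : ℤ)).subtype) θsub →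
        IsTeichmullerLiftOnQuot (∅ : Set (PadicAlgCl p)) (Φ.map (geomTorsion W (p : ℤ)).subtype)
          (geomTorsion W (p : ℤ)) θquot →
      ∀ (Sf : Finset (HeightOneSpectrum (𝓞 K))),
        (∀ w : HeightOneSpectrum (𝓞 K), w ∈ Sf ↔ ((W.conductorNorm ℤ : ℤ) : 𝓞 K) ∈ w.asIdeal) →
      ∀ (θK : HeckeCharacter K), IsHeckeCharOf ι' (θquot.restrictField K) θK →
      ∀ (S : Finset (HeightOneSpectrum (𝓞 K))),
        (∀ w : HeightOneSpectrum (𝓞 K), w ∈ S ↔ ¬ θK.IsUnramifiedAt w) →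
      ∀ (κ' : ZpExtension K p) (γ' : absoluteGaloisGroup K), ZpExtension.IsTopGeneratorPair κ κ' γ γ' →
      ∀ (Ω δ : ℂ) (Ωp' : (unrIntegers p)ˣ) (G : PowerSeries (PowerSeries (PadicComplexInt p)))
        (g : IwasawaAlgebra₂ p), Ω ≠ 0 →
        (δ ^ 2 = (NumberField.discr K : ℂ) ∨ δ ^ 2 = -(NumberField.discr K : ℂ)) →
        IsKatzMeasure₂ ι' v vbar S κ κ' γ⁻¹ γ'⁻¹ θK⁻¹ Ω δ ((Ωp' : unrIntegers p) : ℂ_[p]) G →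
        (∀ (J : ℤ_[p] →+* PadicComplexInt p),
          (∀ x : ℤ_[p], ((J x : PadicComplexInt p) : ℂ_[p]) = ((x : ℚ_[p]) : ℂ_[p])) →
          Associated (PowerSeries.map (PowerSeries.map J) g) G) →
        (g.map (PowerSeries.constantCoeff (R := ℤ_[p]))).map (IsLocalRing.residue ℤ_[p]) ≠ 0 →
      ∃ n : ℕ, FirstUnitCoeffAt L n ∧
        n + ∑ w ∈ Sf, curveLocalLambda κ (W.baseChange K) w =
          2 * ((g.map (PowerSeries.constantCoeff (R := ℤ_[p]))).map
                (IsLocalRing.residue ℤ_[p])).order.toNat +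
            ∑ w ∈ Sf, (charLocalLambda ∅ κ (θsub.restrictField K) w +
              charLocalLambda ∅ κ (θquot.restrictField K) w))
    (h331 : thm331_rubin_exists_katzMeasure₂_pseudoIso_span_eq)
    (hv5 : ∀ (p : ℕ) [Fact p.Prime] (K : Type) [Field K] [NumberField K], 2 < p →
      IsImaginaryQuadratic K →
      ∀ (v vbar : HeightOneSpectrum (𝓞 K)),
        ((p : ℕ) : 𝓞 K) ∈ v.asIdeal → ((p : ℕ) : 𝓞 K) ∈ vbar.asIdeal → vbar ≠ v →
      ∀ (κ₁ κ₂ : ZpExtension K p) (γ₁ γ₂ : absoluteGaloisGroup K),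
        ZpExtension.IsTopGeneratorPair κ₁ κ₂ γ₁ γ₂ →
      ∀ (θ : FramedGaloisRep K (padicCoeffIntegers (∅ : Set (PadicAlgCl p))) 1) (n : ℕ),
        0 < n → ¬ p ∣ n → (∀ σ : absoluteGaloisGroup K, θ σ ^ n = 1) →
      ∀ (D : DualData₂ κ₁ κ₂ (charModule (∅ : Set (PadicAlgCl p)) θ) vbar γ₁ γ₂)
        (P : Submodule (IwasawaAlgebra₂ p) D.X), Module.IsPseudoNull (IwasawaAlgebra₂ p) P → P = ⊥)
    (hFE : thmII64_katzMeasure₂_functionalEquation) (hO1 : thmI_mu_katzBranch_reflect_eq_zero)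
    (W : WeierstrassCurve ℚ) [W.IsElliptic] [W.IsGloballyMinimal] (p : ℕ) [Fact p.Prime]
    (hLdiv : GoodLatticeDivOnTree W p) :
    GoodLatticeMuLambdaOnTree W p := by
  intro hp hgood hred hanom hGL K _ _ hK hHN hHp hodd h3 hEK hSel ι v vbar hv hvbar hne κ hκ γ hγ N _ Dt
    H ιC P hP ι' hι' ΩK Ωp L hΩK hL F hF
  -- §0: L-div at the data
  obtain ⟨-, k, hk⟩ := hLdiv hp hgood hred hanom hGL K hK hHN hHp hodd h3 hEK hSel ι v vbar hv hvbar hne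
    κ hκ γ N Dt H ιC P hP ι' hι' ΩK Ωp L hΩK hL
  obtain ⟨Φ, hΦ, θsub, θquot, hsub, hquot⟩ := exists_teichmullerPair W p hred
  have hpair : IsResidualPairOver (W.baseChange K) p (θsub.restrictField K) (θquot.restrictField K) :=
    isResidualPairOver_restrictField W p K hΦ hsub hquot
  have hN0 : W.conductorNorm ℤ ≠ 0 := (W.conductorNorm_pos_holds).ne'
  obtain ⟨Sf, hSf⟩ := exists_finset_places_dvd (K := K) (N := W.conductorNorm ℤ) hN0
  have hT1K : ∀ σ : absoluteGaloisGroup K, θquot.restrictField K σ ^ (p - 1) = 1 := fun σ ↦ hquot.1 _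
  obtain ⟨θK, -, hθK'⟩ := exists_heckeCharacter_of_pow_eq_one ∅ ι' (θquot.restrictField K) hT1K
  have hθK : IsHeckeCharOf ι' (θquot.restrictField K) θK := hθK'
  obtain ⟨Dsub⟩ := nonempty_unrDualData_char (∅ : Set (PadicAlgCl p)) (θsub.restrictField K) κ vbar
    (∅ : Set (HeightOneSpectrum (𝓞 K))) hγ.out
  obtain ⟨Dquot⟩ := nonempty_unrDualData_char (∅ : Set (PadicAlgCl p)) (θquot.restrictField K) κ vbar
    (∅ : Set (HeightOneSpectrum (𝓞 K))) hγ.out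
  obtain ⟨S, κ', γ', Ω, δ, Ωp₂, G, g, hS, hgen, hΩ, hδ, hG, hJ, hg0, ⟨-, -, -, hlam1⟩, -, -, -, hlamω⟩ :=
    goodLattice_jointMuLambda_of_facts h331 hv5 hFE hO1 W p hp hgood hred hanom hGL K hK hHN hHp hodd h3
      hEK hv hvbar hne hκ hι' hΦ hsub hquot hθK Dsub Dquot
  have hRHsub : ∀ D : DatumDualData κ γ (charModule ∅ (θsub.restrictField K))
      (AcSelmer.bdpData (charModule ∅ (θsub.restrictField K)) p vbar) (∅ : Set (HeightOneSpectrum (𝓞 K))),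
      Module.Finite (IwasawaAlgebra p) D.X ∧ Module.IsTorsion (IwasawaAlgebra p) D.X ∧
        muInvariant p D.X = 0 := fun D ↦ by
    obtain ⟨_, _, _, _, _, _, _, _, -, -, -, -, -, -, -, -, hfin, htors, hmu, -⟩ :=
      goodLattice_jointMuLambda_of_facts h331 hv5 hFE hO1 W p hp hgood hred hanom hGL K hK hHN hHp hodd h3
        hEK hv hvbar hne hκ hι' hΦ hsub hquot hθK D Dquot
    exact ⟨hfin, htors, hmu⟩
  have hRHquot : ∀ D : DatumDualData κ γ (charModule ∅ (θquot.restrictField K))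
      (AcSelmer.bdpData (charModule ∅ (θquot.restrictField K)) p vbar) (∅ : Set (HeightOneSpectrum (𝓞 K))),
      Module.Finite (IwasawaAlgebra p) D.X ∧ Module.IsTorsion (IwasawaAlgebra p) D.X ∧
        muInvariant p D.X = 0 := fun D ↦ by
    obtain ⟨_, _, _, _, _, _, _, _, -, -, -, -, -, -, -, ⟨hfin, htors, hmu, -⟩, -⟩ :=
      goodLattice_jointMuLambda_of_facts h331 hv5 hFE hO1 W p hp hgood hred hanom hGL K hK hHN hHp hodd h3
        hEK hv hvbar hne hκ hι' hΦ hsub hquot hθK Dsub D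
    exact ⟨hfin, htors, hmu⟩
  -- §5′: the `f`-side `≤` at the data (its two `𝔛_f` inputs from [ALG-imp] at any imprimitive dual data)
  obtain ⟨hSsub, -⟩ := h125 W p hp hgood hred hanom hGL K hK hHN hHp hEK ι v vbar hv hvbar hne κ hκ γ
    (θsub.restrictField K) (θquot.restrictField K) hpair Sf hSf (θsub.restrictField K) (Or.inl rfl) hRHsub
  obtain ⟨hSquot, -⟩ := h125 W p hp hgood hred hanom hGL K hK hHN hHp hEK ι v vbar hv hvbar hne κ hκ γ
    (θsub.restrictField K) (θquot.restrictField K) hpair Sf hSf (θquot.restrictField K) (Or.inr rfl) hRHquot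
  obtain ⟨-, ⟨hfg0, htor0, -⟩⟩ :=
    Thm141TorsionClauses.moduleFinite_isTorsion_muInvariant_eq_zero_of_forall_dualData W hp K hK vbar hvbar
      κ hκ γ hpair Sf hSf hSsub hSquot
  have hcf := h142le W p hp hgood hred hanom hGL K hK hHN hHp hEK ι v vbar hv hvbar hne κ hκ γ Sf hSf
    hfg0 htor0
  -- §5: [ALG]-`≤` = [ALG-imp] + [PWL-θ] + [PWL-f]-`≤` + [RH] (pointwise glue)
  obtain ⟨hXfin, hXtors, hXmu, hXlam⟩ := thm151ConclusionLE_of_lambdaTD_at h141lamTD h125 W p hp hgood hred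
    hanom hGL K hK hHN hHp hEK ι v vbar hv hvbar hne κ hκ γ (θsub.restrictField K) (θquot.restrictField K)
    hpair Sf hSf hRHsub hRHquot Dsub Dquot hcf
  obtain ⟨m, hm, hman⟩ := hanQ W p hp hgood hred hanom hGL K hK hHN hHp hodd h3 hEK ι v vbar hv
    hvbar hne κ hκ γ N Dt ι' hι' ΩK Ωp L hΩK hL Φ hΦ θsub θquot hsub hquot Sf hSf θK hθK S hS κ' γ' hgen Ω
    δ Ωp₂ G g hΩ hδ hG hJ hg0
  -- §7: bookkeeping: `λ(𝓛) ≤ λ(𝔛)`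
  have hmle : m ≤ lambdaInvariant p (AcSelmer.XAc (W.baseChange K) p κ vbar ∅ γ) :=
    le_lambda_of_alg_le_of_an_of_bridge hXlam hman hlamω hlam1
  -- §8: the Weierstrass dictionary on the generator `F`, and L-div: `λ(𝔛) ≤ λ(𝓛)`
  haveI := hXfin
  have hFU := firstUnitCoeff_map_toUnr_of_charIdeal_eq_span
    (AcSelmer.XAc (W.baseChange K) p κ vbar ∅ γ) hXtors hXmu (F := F) hF
  have hL' : FirstUnitCoeffAt L m := (firstUnitCoeffAt_iff L m).mp hm
  have hchar : Castella2018.AcSelmer.XAc.charIdeal (W.baseChange K) p κ vbar ∅ γ = Ideal.span {F} := hF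
  rw [hchar, Ideal.map_span, Set.image_singleton] at hk
  have hle : lambdaInvariant p (AcSelmer.XAc (W.baseChange K) p κ vbar ∅ γ) ≤ m :=
    le_of_C_pow_mul_mem hk ((firstUnitCoeffAt_iff _ _).mpr hFU) hL'
  have hlamX : lambdaInvariant p (AcSelmer.XAc (W.baseChange K) p κ vbar ∅ γ) = m := le_antisymm hle hmle
  rw [hlamX] at hFU
  exact ⟨m, hFU, hm⟩

/-! ## §2 The crux BY NAME with [AN] in the ℚ-currency -/
/-- **THE CRUX BY NAME — `Theses.EisensteinPrimes.GoodLatticeBDPValue` — from the PUBLISHED named facts +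
Carayol, the bare `λ`-identity of KY Thm. 1.4.1 (`h141lam`, PRE), [PWL-θ] (imprimitive form), the `≤` HALF
of [PWL-f], and [AN]-DS-Free IN THE ℚ-CURRENCY (`hanQ`).** Composition = `KellerYinHalves.thm308_of_cgls_of_muLambda`
on §1 with Rubin 5.3 (v) h_K-free = `noPseudoNull_of_pub`. CONDITIONAL (audit `proof.conditional` on exactly
the named hypotheses); closes nothing by itself; BSD is proved for no curve. [claim: KellerYin2024, status: under-review]
[cite: KellerYin2024, Thm. 3.0.8 (IMC2) and proof (arXiv:2402.12781v2 TeX L1631–1640), Thm. 1.4.1, proof of Thm. 1.5.1, Thms. 2.2.1–2.2.3]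
[cite: CastellaGrossiLeeSkinner2022, proof of Thm. 4.2.2, Thm. 4.1.2, Prop. 4.2.1, Thm. 5.1.3, Thm. 2.2.2, proof of Thm. 1.5.1, Prop. 1.2.5]
[cite: PollackWeston2011, App. A Prop. A.2] [cite: CastellaHsieh2018, Def. 3.7 and Prop. 3.8] [cite: Carayol1986]
[cite: BleherEtAl2020, §3.3 Thm. 3.3.1] [cite: deShalit1987, II.6.4 Theorem (i)] [cite: Hida2010MuInvariant, Thm. I]
[cite: Greenberg2016Selmer, Prop. 4.1.1, Prop. 4.2.2] [cite: Greenberg2006, §5 A, Props. 3.2, 4.1, 4.2] [cite: NguyenQuangDo1984, Thm. 2.2] -/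
theorem goodLatticeBDPValue_of_pub_of_lambdaTD_of_le_of_anQ
    (hCH : castellaHsieh2018_exists_isBDPLFunction)
    (hC : ∀ (N : ℕ) [NeZero N], IsNewformOf.level_eq_conductorNorm (N := N))
    (hdiv : proofThm422_exists_isBDPLFunction_isTorsion_charIdeal_dvd)
    (hval : thm513_exists_isBDPLFunction_valueAtOne)
    (h331 : thm331_rubin_exists_katzMeasure₂_pseudoIso_span_eq)
    (hFE : thmII64_katzMeasure₂_functionalEquation) (hO1 : thmI_mu_katzBranch_reflect_eq_zero)
    (h411 : prop411_selmer_isAlmostDivisible)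
    (h422 : prop422_localCohomology_isAlmostDivisible) (h5A : sec5A_localH2_subsingleton_of_LOC1)
    (h41 : prop41_globalEulerPoincareCorank) (h42 : prop42_localEulerPoincareCorank)
    (h32 : prop32_cohomology_isCofinitelyGenerated)
    (h33 : BCGKPST2020.sec33_rubin_unrSelmer₂_finite_torsion)
    (hT4 : weakLeopoldt_H2_subsingleton_above_cyclotomic_of_isOpen)
    (h141lamTD : ∀ (W : WeierstrassCurve ℚ) [W.IsElliptic] [W.IsGloballyMinimal] (p : ℕ) [Fact p.Prime],
      2 < p → Good W p → Red W p → Anom W p →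
      (∀ Φ : AddSubgroup (geomTorsion W (p : ℤ)), IsRationalLine W p Φ → ¬ LineUnramifiedAt W p Φ) →
      ∀ (K : Type) [Field K] [NumberField K], IsImaginaryQuadratic K →
        SatisfiesHeegnerHypothesis (W.conductorNorm ℤ) K → SatisfiesHeegnerHypothesis p K →
        (∀ Q : (W.baseChange K).toAffine.Point, p • Q = 0 → Q = 0) →
      ∀ (ι : K →+* ℚ_[p]) (v vbar : HeightOneSpectrum (𝓞 K)),
        (∀ x : 𝓞 K, x ∈ v.asIdeal ↔ ‖ι (x : K)‖ < 1) →
        ((p : ℕ) : 𝓞 K) ∈ vbar.asIdeal → vbar ≠ v →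
      ∀ (κ : ZpExtension K p), κ.IsAnticyclotomic →
      ∀ (γ : absoluteGaloisGroup K) [Fact (κ.IsTopGenerator γ)],
      ∀ (θsub θquot : FramedGaloisRep K (padicCoeffIntegers (∅ : Set (PadicAlgCl p))) 1),
        IsResidualPairOver (W.baseChange K) p θsub θquot →
      ∀ (Sf : Finset (HeightOneSpectrum (𝓞 K))),
        (∀ w : HeightOneSpectrum (𝓞 K), w ∈ Sf ↔ ((W.conductorNorm ℤ : ℤ) : 𝓞 K) ∈ w.asIdeal) →
      ∀ (DSsub : DatumDualData κ γ (charModule ∅ θsub)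
          (AcSelmer.bdpData (charModule ∅ θsub) p vbar) (↑Sf : Set (HeightOneSpectrum (𝓞 K))))
        (DSquot : DatumDualData κ γ (charModule ∅ θquot)
          (AcSelmer.bdpData (charModule ∅ θquot) p vbar) (↑Sf : Set (HeightOneSpectrum (𝓞 K)))),
      Module.Finite (IwasawaAlgebra p) (AcSelmer.XAc (W.baseChange K) p κ vbar (↑Sf : Set (HeightOneSpectrum (𝓞 K))) γ) →
      Module.IsTorsion (IwasawaAlgebra p) (AcSelmer.XAc (W.baseChange K) p κ vbar (↑Sf : Set (HeightOneSpectrum (𝓞 K))) γ) →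
      muInvariant p (AcSelmer.XAc (W.baseChange K) p κ vbar (↑Sf : Set (HeightOneSpectrum (𝓞 K))) γ) = 0 →
      (∀ D : DatumDualData κ γ (charModule ∅ θsub)
          (AcSelmer.bdpData (charModule ∅ θsub) p vbar) (↑Sf : Set (HeightOneSpectrum (𝓞 K))),
        Module.Finite (IwasawaAlgebra p) D.X ∧ Module.IsTorsion (IwasawaAlgebra p) D.X ∧ muInvariant p D.X = 0) →
      (∀ D : DatumDualData κ γ (charModule ∅ θquot)
          (AcSelmer.bdpData (charModule ∅ θquot) p vbar) (↑Sf : Set (HeightOneSpectrum (𝓞 K))),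
        Module.Finite (IwasawaAlgebra p) D.X ∧ Module.IsTorsion (IwasawaAlgebra p) D.X ∧ muInvariant p D.X = 0) →
      lambdaInvariant p (AcSelmer.XAc (W.baseChange K) p κ vbar (↑Sf : Set (HeightOneSpectrum (𝓞 K))) γ) +
          (if ∀ σ : absoluteGaloisGroup K, θquot σ = 1 then 1 else 0) =
        lambdaInvariant p DSsub.X + lambdaInvariant p DSquot.X)
    (h125 : prop125_residualPair_unrSelmer_imprimitive)
    (h142le : ∀ (W : WeierstrassCurve ℚ) [W.IsElliptic] [W.IsGloballyMinimal] (p : ℕ) [Fact p.Prime],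
      2 < p → Good W p → Red W p → Anom W p →
      (∀ Φ : AddSubgroup (geomTorsion W (p : ℤ)), IsRationalLine W p Φ → ¬ LineUnramifiedAt W p Φ) →
      ∀ (K : Type) [Field K] [NumberField K], IsImaginaryQuadratic K →
        SatisfiesHeegnerHypothesis (W.conductorNorm ℤ) K → SatisfiesHeegnerHypothesis p K →
        (∀ Q : (W.baseChange K).toAffine.Point, p • Q = 0 → Q = 0) →
      ∀ (ι : K →+* ℚ_[p]) (v vbar : HeightOneSpectrum (𝓞 K)),
        (∀ x : 𝓞 K, x ∈ v.asIdeal ↔ ‖ι (x : K)‖ < 1) →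
        ((p : ℕ) : 𝓞 K) ∈ vbar.asIdeal → vbar ≠ v →
      ∀ (κ : ZpExtension K p), κ.IsAnticyclotomic →
      ∀ (γ : absoluteGaloisGroup K) [Fact (κ.IsTopGenerator γ)],
      ∀ (Sf : Finset (HeightOneSpectrum (𝓞 K))),
        (∀ w : HeightOneSpectrum (𝓞 K), w ∈ Sf ↔ ((W.conductorNorm ℤ : ℤ) : 𝓞 K) ∈ w.asIdeal) →
      Module.Finite (IwasawaAlgebra p) (AcSelmer.XAc (W.baseChange K) p κ vbar ∅ γ) →
      Module.IsTorsion (IwasawaAlgebra p) (AcSelmer.XAc (W.baseChange K) p κ vbar ∅ γ) →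
      zpCorank (↥(AcSelmer.selmerAc (W.baseChange K) p κ vbar (↑Sf : Set (HeightOneSpectrum (𝓞 K)))) ⧸
          (AcSelmer.selmerAc (W.baseChange K) p κ vbar (∅ : Set (HeightOneSpectrum (𝓞 K)))).addSubgroupOf
            (AcSelmer.selmerAc (W.baseChange K) p κ vbar (↑Sf : Set (HeightOneSpectrum (𝓞 K))))) p ≤
        ∑ w ∈ Sf, curveLocalLambda κ (W.baseChange K) w)
    (hanQ : ∀ (W : WeierstrassCurve ℚ) [W.IsElliptic] [W.IsGloballyMinimal] (p : ℕ) [Fact p.Prime],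
      2 < p → Good W p → Red W p → Anom W p →
      (∀ Φ : AddSubgroup (geomTorsion W (p : ℤ)), IsRationalLine W p Φ → ¬ LineUnramifiedAt W p Φ) →
      ∀ (K : Type) [Field K] [NumberField K], IsImaginaryQuadratic K →
        SatisfiesHeegnerHypothesis (W.conductorNorm ℤ) K → SatisfiesHeegnerHypothesis p K →
        Odd (NumberField.discr K) → NumberField.discr K ≠ -3 →
        (∀ Q : (W.baseChange K).toAffine.Point, p • Q = 0 → Q = 0) →
      ∀ (ι : K →+* ℚ_[p]) (v vbar : HeightOneSpectrum (𝓞 K)),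
        (∀ x : 𝓞 K, x ∈ v.asIdeal ↔ ‖ι (x : K)‖ < 1) →
        ((p : ℕ) : 𝓞 K) ∈ vbar.asIdeal → vbar ≠ v →
      ∀ (κ : ZpExtension K p), κ.IsAnticyclotomic →
      ∀ (γ : absoluteGaloisGroup K) [Fact (κ.IsTopGenerator γ)],
      ∀ (N : ℕ) [NeZero N] (Dt : ModularParametrizationData W N),
      ∀ (ι' : PadicAlgCl p ≃+* ℂ),
        (∀ (w : InfinitePlace K) (k : 𝓞 K), k ∈ v.asIdeal ↔ ‖ι'.symm (w.embedding (k : K))‖ < 1) →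
      ∀ (ΩK : ℂ) (Ωp : (unrIntegers p)ˣ) (L : UnrSeries p), ΩK ≠ 0 →
        IsBDPLFunction ι' v κ γ Dt.f ΩK ((Ωp : unrIntegers p) : ℂ_[p]) L →
      ∀ (Φ : AddSubgroup (geomTorsion W (p : ℤ))), IsRationalLine W p Φ →
      ∀ (θsub θquot : FramedGaloisRep ℚ (padicCoeffIntegers (∅ : Set (PadicAlgCl p))) 1),
        IsTeichmullerLiftOn (∅ : Set (PadicAlgCl p)) (Φ.map (geomTorsion W (p : ℤ)).subtype) θsub →
        IsTeichmullerLiftOnQuot (∅ : Set (PadicAlgCl p)) (Φ.map (geomTorsion W (p : ℤ)).subtype)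
          (geomTorsion W (p : ℤ)) θquot →
      ∀ (Sf : Finset (HeightOneSpectrum (𝓞 K))),
        (∀ w : HeightOneSpectrum (𝓞 K), w ∈ Sf ↔ ((W.conductorNorm ℤ : ℤ) : 𝓞 K) ∈ w.asIdeal) →
      ∀ (θK : HeckeCharacter K), IsHeckeCharOf ι' (θquot.restrictField K) θK →
      ∀ (S : Finset (HeightOneSpectrum (𝓞 K))),
        (∀ w : HeightOneSpectrum (𝓞 K), w ∈ S ↔ ¬ θK.IsUnramifiedAt w) →
      ∀ (κ' : ZpExtension K p) (γ' : absoluteGaloisGroup K), ZpExtension.IsTopGeneratorPair κ κ' γ γ' →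
      ∀ (Ω δ : ℂ) (Ωp' : (unrIntegers p)ˣ) (G : PowerSeries (PowerSeries (PadicComplexInt p)))
        (g : IwasawaAlgebra₂ p), Ω ≠ 0 →
        (δ ^ 2 = (NumberField.discr K : ℂ) ∨ δ ^ 2 = -(NumberField.discr K : ℂ)) →
        IsKatzMeasure₂ ι' v vbar S κ κ' γ⁻¹ γ'⁻¹ θK⁻¹ Ω δ ((Ωp' : unrIntegers p) : ℂ_[p]) G →
        (∀ (J : ℤ_[p] →+* PadicComplexInt p),
          (∀ x : ℤ_[p], ((J x : PadicComplexInt p) : ℂ_[p]) = ((x : ℚ_[p]) : ℂ_[p])) →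
          Associated (PowerSeries.map (PowerSeries.map J) g) G) →
        (g.map (PowerSeries.constantCoeff (R := ℤ_[p]))).map (IsLocalRing.residue ℤ_[p]) ≠ 0 →
      ∃ n : ℕ, FirstUnitCoeffAt L n ∧
        n + ∑ w ∈ Sf, curveLocalLambda κ (W.baseChange K) w =
          2 * ((g.map (PowerSeries.constantCoeff (R := ℤ_[p]))).map
                (IsLocalRing.residue ℤ_[p])).order.toNat +
            ∑ w ∈ Sf, (charLocalLambda ∅ κ (θsub.restrictField K) w +
              charLocalLambda ∅ κ (θquot.restrictField K) w)) :
    Summit.BirchSwinnertonDyer.BirchSwinnertonDyer.Theses.EisensteinPrimes.GoodLatticeBDPValue := by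
  unfold Summit.BirchSwinnertonDyer.BirchSwinnertonDyer.Theses.EisensteinPrimes.GoodLatticeBDPValue
  exact thm308_of_cgls_of_muLambda hCH hC hdiv hval
    (fun W _ _ p _ ↦ goodLatticeMuLambdaOnTree_of_div_of_le_of_lambdaTD_of_anQ h141lamTD h125 h142le hanQ
      h331 (noPseudoNull_of_pub h411 h422 h5A h41 h42 h32 h33 hT4) hFE hO1 W p
      (goodLatticeDivOnTree_of_cgls hdiv hC W p))

end Summit.BirchSwinnertonDyer.BirchSwinnertonDyer.Theorems.GoodLatticeBDPValueOfLambdaIdentityTorsDAnQ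

end
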